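import Mathlib
import Literature.Probability.RandomPlanarGeometry.CurveSpace
import Literature.Probability.RandomPlanarGeometry.SimpleCurves
import Literature.Probability.RandomPlanarGeometry.LoopSpaceMaps
import Literature.Probability.RandomPlanarGeometry.PolylineSimple
import Literature.Probability.LatticeModels.LatticeInterface
import HarnessLib

/-!
# The uniform parametrisation of a polyline; time reversal of polyline classes

Topic `Literature/Probability/RandomPlanarGeometry`. The tree's polyline
`LatticeModels.polyline (a :: l) = (LatticeModels.polylineFrom a l).2` runs through its vertices
with the DYADIC time parametrisation of iterated `Path.trans` (segment `k` in time `2^{-(k+1)}`,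
constant tail of length `2^{-n}`). This file factors it as

  `polylineFrom a l t = uniform a l (clock n t)`, `n = l.length`
  (`polylineFrom_apply_eq_uniform_clock`),

through the **uniform parametrisation** `uniform a l : ℝ → E` (segment `k` traversed affinely
during `[k, k+1]`, constant `= last vertex` after time `n`) and the **dyadic clock**
`clock n : ℝ → ℝ`, a continuous monotone map with `clock n 0 = 0`, `clock n 1 = n`. The uniform
parametrisation of the reversed vertex list is the time reversal `s ↦ n - s` of the uniform
parametrisation (`uniform_reverse`), whence, by the tree's "monotone reparametrisations do not
change the class" (`Curve.dist_precomp_eq_zero`, `SimpleCurves.lean`):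

* `Polyline.reverse_mk_polyline` — **the time reversal of the class of the polyline through
  `v₀, …, v_n` is the class of the polyline through `v_n, …, v₀`**:
  `(CurveClass.mk ⟨polyline L⟩).reverse = CurveClass.mk ⟨polyline L.reverse⟩`.

Used for the reversibility of the off-lattice self-avoiding walk (`FreelyJointedSAW.law`).
Elementary real-variable bookkeeping (Camia–Newman 2007, §2: lattice paths as polygonal curves,
"any parametrisation"; Aizenman–Burchard 1999, §2.1); tagged [folklore].
-/

noncomputable section

open Set Function
open scoped unitInterval Topology

namespace Literature.Probability.RandomPlanarGeometry

namespace Polyline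

open Literature.Probability.LatticeModels (polyline polylineFrom polylineFrom_nil polylineFrom_cons)

/-! ### The dyadic clock -/

/-- The **dyadic clock** of an `n`-segment `Path.trans` polyline: `clock 0 = 0` and
`clock (n+1) t = 2t` for `t ≤ 1/2`, `= 1 + clock n (2t - 1)` for `t ≥ 1/2`; on `[0, 1]` it is the
continuous monotone piecewise-affine map onto `[0, n]` sending the dyadic time of the `k`-th
vertex, `1 - 2^{-k}`, to `k`. [folklore] -/
def clock : ℕ → ℝ → ℝ
  | 0, _ => 0
  | n + 1, t => if t ≤ 1 / 2 then 2 * t else 1 + clock n (2 * t - 1)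

/-- `clock 0 = 0`. [folklore] -/
@[simp] theorem clock_zero_left (t : ℝ) : clock 0 t = 0 := rfl

/-- The defining recursion of the clock. [folklore] -/
theorem clock_succ (n : ℕ) (t : ℝ) :
    clock (n + 1) t = if t ≤ 1 / 2 then 2 * t else 1 + clock n (2 * t - 1) := rfl

/-- The clock starts at `0`. [folklore] -/
@[simp] theorem clock_zero (n : ℕ) : clock n 0 = 0 := by
  cases n with
  | zero => rfl
  | succ n => rw [clock_succ, if_pos (by norm_num)]; ring

/-- The clock ends at `n`. [folklore] -/
@[simp] theorem clock_one : ∀ n : ℕ, clock n 1 = n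
  | 0 => by simp
  | n + 1 => by
      rw [clock_succ, if_neg (by norm_num), show (2 : ℝ) * 1 - 1 = 1 by norm_num, clock_one n]
      push_cast
      ring

/-- The clock is nonnegative at nonnegative times. [folklore] -/
theorem clock_nonneg : ∀ (n : ℕ) {t : ℝ}, 0 ≤ t → 0 ≤ clock n t
  | 0, _, _ => le_rfl
  | n + 1, t, ht => by
      rw [clock_succ]
      split_ifs with h
      · linarith
      · have := clock_nonneg n (t := 2 * t - 1) (by linarith)
        linarith

/-- The clock is monotone. [folklore] -/
theorem monotone_clock : ∀ n : ℕ, Monotone (clock n)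
  | 0 => fun _ _ _ => le_rfl
  | n + 1 => fun s t hst => by
      rw [clock_succ, clock_succ]
      split_ifs with hs ht ht
      · linarith
      · have := clock_nonneg n (t := 2 * t - 1) (by linarith)
        linarith
      · exact absurd (hst.trans ht) hs
      · have := monotone_clock n (show 2 * s - 1 ≤ 2 * t - 1 by linarith)
        linarith

/-- The clock is continuous. [folklore] -/
theorem continuous_clock : ∀ n : ℕ, Continuous (clock n)
  | 0 => continuous_const
  | n + 1 => by
      have h : Continuous fun t : ℝ => 1 + clock n (2 * t - 1) :=
        continuous_const.add ((continuous_clock n).comp (by fun_prop))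
      change Continuous fun t : ℝ => if t ≤ 1 / 2 then 2 * t else 1 + clock n (2 * t - 1)
      refine Continuous.if_le (by fun_prop) h continuous_id continuous_const ?_
      rintro t rfl
      norm_num

/-- On `[0, 1]` the clock takes values in `[0, n]`. [folklore] -/
theorem clock_mem_Icc (n : ℕ) {t : ℝ} (ht : t ∈ Icc (0 : ℝ) 1) : clock n t ∈ Icc (0 : ℝ) n :=
  ⟨clock_nonneg n ht.1, by simpa using monotone_clock n ht.2⟩

/-! ### The uniform parametrisation -/

variable {E : Type*} [AddCommGroup E] [Module ℝ E] [TopologicalSpace E] [ContinuousAdd E]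
  [ContinuousSMul ℝ E]

/-- The **uniform parametrisation** of the polyline from `a` through the points of `l`: the
`k`-th segment is traversed affinely during the time interval `[k, k+1]`, and the path rests at
the last vertex after time `l.length` (and at `a` before time `0`). [folklore] -/
def uniform : E → List E → ℝ → E
  | a, [], _ => a
  | a, b :: l, s => if s ≤ 1 then (Path.segment a b).extend s else uniform b l (s - 1)

/-- `uniform a []` is constant. [folklore] -/
@[simp] theorem uniform_nil (a : E) (s : ℝ) : uniform a [] s = a := rfl

/-- The defining recursion of `uniform`. [folklore] -/
theorem uniform_cons (a b : E) (l : List E) (s : ℝ) :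
    uniform a (b :: l) s = if s ≤ 1 then (Path.segment a b).extend s else uniform b l (s - 1) :=
  rfl

/-- The uniform parametrisation rests at `a` up to time `0`. [folklore] -/
theorem uniform_of_nonpos (a : E) (l : List E) {s : ℝ} (hs : s ≤ 0) : uniform a l s = a := by
  cases l with
  | nil => rfl
  | cons b l => rw [uniform_cons, if_pos (by linarith), Path.extend_of_le_zero _ hs]

/-- The uniform parametrisation starts at `a`. [folklore] -/
@[simp] theorem uniform_zero (a : E) (l : List E) : uniform a l 0 = a :=
  uniform_of_nonpos a l le_rfl

/-- **Segmentwise formula**: during `[i, i+1]` the uniform parametrisation traverses the `i`-th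
segment affinely. [folklore] -/
theorem uniform_apply_add : ∀ (l : List E) (a : E) (i : ℕ) (hi : i < l.length) {s : ℝ}
    (_ : s ∈ Icc (0 : ℝ) 1),
    uniform a l (i + s) = AffineMap.lineMap ((a :: l)[i]'(by simp; omega))
      ((a :: l)[i + 1]'(by simp; omega)) s
  | [], _, i, hi, _, _ => by simp at hi
  | b :: l, a, 0, _, s, hs => by
      rw [uniform_cons, Nat.cast_zero, zero_add, if_pos hs.2, Path.extend_apply _ hs,
        Path.segment_apply]
      rfl
  | b :: l, a, i + 1, hi, s, hs => by
      rw [uniform_cons]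
      by_cases h : ((i + 1 : ℕ) : ℝ) + s ≤ 1
      · -- then `i = 0` and `s = 0`: both sides are the vertex `b`
        push_cast at h
        have hi0 : i = 0 := by
          by_contra hne
          have : (1 : ℝ) ≤ i := by exact_mod_cast Nat.one_le_iff_ne_zero.2 hne
          linarith [hs.1]
        subst hi0
        have hs0 : s = 0 := by linarith [hs.1]
        subst hs0
        rw [if_pos (by push_cast; linarith)]
        simp
      · rw [if_neg h, show ((i + 1 : ℕ) : ℝ) + s - 1 = (i : ℕ) + s by push_cast; ring]
        have hi' : i < l.length := by simpa using hi
        rw [uniform_apply_add l b i hi' hs]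
        simp

/-- After time `l.length` the uniform parametrisation rests at the last vertex. [folklore] -/
theorem uniform_of_length_le : ∀ (l : List E) (a : E) {s : ℝ}, (l.length : ℝ) ≤ s →
    uniform a l s = (a :: l).getLast (List.cons_ne_nil a l)
  | [], a, s, _ => by simp
  | b :: l, a, s, hs => by
      rw [uniform_cons]
      have hs' : (l.length : ℝ) ≤ s - 1 := by
        simp only [List.length_cons, Nat.cast_add, Nat.cast_one] at hs
        linarith
      split_ifs with h
      · -- `l = []` and `s = 1`
        have hl : l.length = 0 := by
          by_contra hne
          have : (1 : ℝ) ≤ l.length := by exact_mod_cast Nat.one_le_iff_ne_zero.2 hne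
          linarith
        have hl' : l = [] := List.length_eq_zero_iff.1 hl
        subst hl'
        have hs1 : s = 1 := le_antisymm h (by simpa using hs)
        subst hs1
        simp
      · rw [uniform_of_length_le l b hs', List.getLast_cons (List.cons_ne_nil b l)]

/-- The uniform parametrisation is continuous (the affine pieces agree at the vertices).
[folklore] -/
theorem continuous_uniform : ∀ (l : List E) (a : E), Continuous (uniform a l)
  | [], a => continuous_const
  | b :: l, a => by
      change Continuous fun s : ℝ => if s ≤ 1 then (Path.segment a b).extend s else uniform b l (s - 1)
      refine Continuous.if_le (Path.continuous_extend _) ((continuous_uniform l b).comp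
        (continuous_id.sub continuous_const)) continuous_id continuous_const ?_
      rintro s rfl
      rw [Path.extend_one, sub_self, uniform_zero]

/-! ### The factorisation `polylineFrom = uniform ∘ clock` -/

/-- **The dyadic polyline is the uniform polyline run with the dyadic clock.** [folklore] -/
theorem polylineFrom_apply_eq_uniform_clock :
    ∀ (l : List E) (a : E) (t : I), (polylineFrom a l).2 t = uniform a l (clock l.length t)
  | [], _, _ => rfl
  | b :: l, a, t => by
      change ((Path.segment a b).trans (polylineFrom b l).2) t = _
      rw [path_trans_apply_ite, List.length_cons, clock_succ, uniform_cons]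
      have ht0 := t.2.1
      have ht1 := t.2.2
      by_cases h : (t : ℝ) ≤ 1 / 2
      · rw [if_pos h, if_pos h, if_pos (by linarith)]
      · rw [if_neg h, if_neg h, Path.extend_apply _ ⟨by linarith, by linarith⟩,
          polylineFrom_apply_eq_uniform_clock l b ⟨2 * t - 1, by linarith, by linarith⟩]
        have hc := clock_nonneg l.length (t := 2 * (t : ℝ) - 1) (by linarith)
        rcases hc.eq_or_lt with hc0 | hcpos
        · rw [← hc0, if_pos (by norm_num), add_zero, Path.extend_one, uniform_zero]
        · rw [if_neg (by linarith), add_sub_cancel_left]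

/-- `polyline` form of the factorisation. [folklore] -/
theorem polyline_apply_eq_uniform_clock (a : E) (l : List E) (t : I) :
    polyline (a :: l) t = uniform a l (clock l.length t) :=
  polylineFrom_apply_eq_uniform_clock l a t

/-! ### Reversal of the vertex list is time reversal of the uniform parametrisation -/

/-- Segmentwise formula indexed over the whole vertex list `L = a :: l`. [folklore] -/
theorem uniform_head_tail_apply_add (L : List E) (hL : L ≠ []) (i : ℕ) (hi : i + 1 < L.length)
    {s : ℝ} (hs : s ∈ Icc (0 : ℝ) 1) :
    uniform (L.head hL) L.tail (i + s) =
      AffineMap.lineMap (L[i]'(by omega)) (L[i + 1]'hi) s := by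
  obtain ⟨a, l, rfl⟩ := List.exists_cons_of_ne_nil hL
  simp only [List.head_cons, List.tail_cons, List.length_cons] at hi ⊢
  exact uniform_apply_add l a i (by omega) hs

/-- **Reversing the vertex list reverses uniform time**: for `L` with `n + 1` vertices and
`s ∈ [0, n]`, the uniform polyline of `L.reverse` at time `s` is the uniform polyline of `L` at
time `n - s`. [folklore] -/
theorem uniform_reverse (L : List E) (hL : L ≠ []) {n : ℕ} (hLn : L.length = n + 1) {s : ℝ}
    (hs0 : 0 ≤ s) (hsn : s ≤ n) :
    uniform (L.reverse.head (by simpa using hL)) L.reverse.tail s =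
      uniform (L.head hL) L.tail ((n : ℝ) - s) := by
  rcases Nat.eq_zero_or_pos n with hn0 | hnpos
  · -- a single vertex: `L = [a]`, `s = 0`
    subst hn0
    rw [Nat.cast_zero] at hsn
    have hs : s = 0 := le_antisymm hsn hs0
    subst hs
    obtain ⟨a, l, rfl⟩ := List.exists_cons_of_ne_nil hL
    have hl : l = [] := by
      have h0 : l.length = 0 := by
        simp only [List.length_cons] at hLn
        omega
      exact List.length_eq_zero_iff.1 h0
    subst hl
    simp
  -- write `s = i + r` with `i < n`, `r ∈ [0, 1]`
  obtain ⟨i, r, hi, hr, rfl⟩ : ∃ (i : ℕ) (r : ℝ), i < n ∧ r ∈ Icc (0 : ℝ) 1 ∧ s = i + r := by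
    rcases eq_or_lt_of_le hsn with h | h
    · refine ⟨n - 1, 1, by omega, ⟨zero_le_one, le_rfl⟩, ?_⟩
      rw [h, Nat.cast_sub hnpos]
      push_cast
      ring
    · refine ⟨⌊s⌋₊, s - ⌊s⌋₊, (Nat.floor_lt hs0).2 h, ⟨?_, ?_⟩, by ring⟩
      · linarith [Nat.floor_le hs0]
      · linarith [Nat.lt_floor_add_one s]
  have hi1 : i + 1 < L.reverse.length := by rw [List.length_reverse]; omega
  rw [uniform_head_tail_apply_add L.reverse (by simpa using hL) i hi1 hr]
  -- the right-hand side: time `n - (i + r) = (n - 1 - i) + (1 - r)`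
  have hj : n - 1 - i + 1 < L.length := by omega
  have hr' : 1 - r ∈ Icc (0 : ℝ) 1 := ⟨by linarith [hr.2], by linarith [hr.1]⟩
  have htime : (n : ℝ) - (i + r) = ((n - 1 - i : ℕ) : ℝ) + (1 - r) := by
    rw [Nat.cast_sub (by omega), Nat.cast_sub hnpos]
    push_cast
    ring
  rw [htime, uniform_head_tail_apply_add L hL (n - 1 - i) hj hr', ← AffineMap.lineMap_apply_one_sub]
  -- the vertices match: `L.reverse[i+1] = L[n - 1 - i]`, `L.reverse[i] = L[n - i]`
  have h1 : L.reverse[i + 1]'hi1 = L[n - 1 - i]'(by omega) := by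
    rw [List.getElem_reverse]
    congr 1
    omega
  have h2 : L.reverse[i]'(by omega) = L[n - 1 - i + 1]'hj := by
    rw [List.getElem_reverse]
    congr 1
    omega
  rw [h1, h2]

/-! ### Time reversal of polyline classes -/

section Normed

variable {F : Type*} [NormedAddCommGroup F] [NormedSpace ℝ F]

/-- **Time reversal of a polyline class is the class of the reversed vertex list**:
`(mk (polyline L)).reverse = mk (polyline L.reverse)`. Both the reversed dyadic polyline and the
dyadic polyline of the reversed list are the time-reversed uniform polyline
`s ↦ uniform a l (n (1 - s))` run with continuous monotone onto clocks (`1 - clock n (1 - t)/n`,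
resp. `clock n t / n`), hence at reparametrisation distance `0` from it
(`Curve.dist_precomp_eq_zero`). [folklore] -/
theorem reverse_mk_polyline (L : List F) :
    (CurveClass.mk ⟨polyline L⟩).reverse = CurveClass.mk ⟨polyline L.reverse⟩ := by
  rcases L with _ | ⟨a, l⟩
  · rw [List.reverse_nil, CurveClass.reverse_mk]
    congr 1
  rcases Nat.eq_zero_or_pos l.length with hl0 | hlpos
  · have hl : l = [] := List.length_eq_zero_iff.1 hl0
    subst hl
    rw [List.reverse_singleton, CurveClass.reverse_mk]
    congr 1
  -- the main case: `n = l.length ≥ 1` segments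
  set n := l.length with hn
  have hLn : (a :: l).length = n + 1 := by simp [hn]
  have hn0 : (0 : ℝ) < n := by exact_mod_cast hlpos
  -- the common curve: the time-reversed uniform polyline, rescaled to `[0, 1]`
  let c : Curve F := ⟨⟨fun s : I => uniform a l (n * (1 - (s : ℝ))),
    (continuous_uniform l a).comp (by fun_prop)⟩⟩
  have hc : ∀ s : I, c s = uniform a l (n * (1 - (s : ℝ))) := fun s => rfl
  -- the two clocks
  have hφmem : ∀ t : I, clock n t / n ∈ I := fun t => by
    obtain ⟨h0, h1⟩ := clock_mem_Icc n ⟨t.2.1, t.2.2⟩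
    exact ⟨div_nonneg h0 hn0.le, div_le_one_of_le₀ h1 hn0.le⟩
  let φ₂ : C(I, I) := ⟨fun t => ⟨clock n t / n, hφmem t⟩,
    Continuous.subtype_mk (((continuous_clock n).comp continuous_subtype_val).div_const _) _⟩
  have hφ₂ : ∀ t : I, (φ₂ t : ℝ) = clock n t / n := fun t => rfl
  have hφ₂_mono : Monotone φ₂ := fun s t hst => by
    change clock n s / n ≤ clock n t / n
    exact div_le_div_of_nonneg_right (monotone_clock n hst) hn0.le
  have hφ₂_zero : φ₂ 0 = 0 := Subtype.ext (by simp [hφ₂])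
  have hφ₂_one : φ₂ 1 = 1 := Subtype.ext (by
    rw [hφ₂]
    change clock n 1 / n = 1
    rw [clock_one, div_self hn0.ne'])
  let φ₁ : C(I, I) := ⟨fun t => σ (φ₂ (σ t)), by fun_prop⟩
  have hφ₁ : ∀ t : I, φ₁ t = σ (φ₂ (σ t)) := fun t => rfl
  have hφ₁_mono : Monotone φ₁ := fun s t hst => by
    rw [hφ₁, hφ₁]
    exact unitInterval.symm_le_symm.2 (hφ₂_mono (unitInterval.symm_le_symm.2 hst))
  have hφ₁_zero : φ₁ 0 = 0 := by
    rw [hφ₁, unitInterval.symm_zero, hφ₂_one, unitInterval.symm_one]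
  have hφ₁_one : φ₁ 1 = 1 := by
    rw [hφ₁, unitInterval.symm_one, hφ₂_zero, unitInterval.symm_zero]
  -- (1) the reversed dyadic polyline is `c ∘ φ₁`
  have h1 : c.precomp φ₁ = (⟨polyline (a :: l)⟩ : Curve F).reverse := by
    ext t
    change c (φ₁ t) = polyline (a :: l) (σ t)
    rw [hc, hφ₁, unitInterval.coe_symm_eq, hφ₂, polyline_apply_eq_uniform_clock, ← hn]
    congr 1
    field_simp
    ring
  -- (2) the dyadic polyline of the reversed list is `c ∘ φ₂`
  have h2 : c.precomp φ₂ = (⟨polyline (a :: l).reverse⟩ : Curve F) := by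
    ext t
    change c (φ₂ t) = polyline (a :: l).reverse t
    rw [hc, hφ₂]
    obtain ⟨a', l', h'⟩ := List.exists_cons_of_ne_nil (List.reverse_ne_nil_iff.2 (List.cons_ne_nil a l))
    have hl' : l'.length = n := by
      have := congrArg List.length h'
      simp only [List.length_reverse, List.length_cons] at this
      omega
    rw [h', polyline_apply_eq_uniform_clock, hl']
    have hrev := uniform_reverse (a :: l) (List.cons_ne_nil a l) hLn (s := clock n t)
      (clock_nonneg n t.2.1) (clock_mem_Icc n ⟨t.2.1, t.2.2⟩).2
    simp only [h', List.head_cons, List.tail_cons] at hrev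
    rw [hrev]
    congr 1
    field_simp
  -- conclude: both are at reparametrisation distance `0` from `c`
  have hd1 := Curve.dist_precomp_eq_zero c φ₁ hφ₁_mono hφ₁_zero hφ₁_one
  have hd2 := Curve.dist_precomp_eq_zero c φ₂ hφ₂_mono hφ₂_zero hφ₂_one
  rw [h1] at hd1
  rw [h2] at hd2
  rw [CurveClass.reverse_mk, CurveClass.mk_eq_mk_iff_dist_eq_zero.2 hd1,
    ← CurveClass.mk_eq_mk_iff_dist_eq_zero.2 hd2]

/-- `Fin`-indexed form: reversing the order of the vertices reverses the polyline class
(`(ofFn v).reverse = ofFn (v ∘ Fin.rev)`, the tree's `List.reverse_ofFn'`, re-derived inline to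
keep the imports light). [folklore] -/
theorem reverse_mk_polyline_ofFn {N : ℕ} (v : Fin (N + 1) → F) :
    (CurveClass.mk ⟨polyline (List.ofFn v)⟩).reverse =
      CurveClass.mk ⟨polyline (List.ofFn fun k => v (Fin.rev k))⟩ := by
  have hrev : (List.ofFn v).reverse = List.ofFn fun i => v (Fin.rev i) := by
    apply List.ext_getElem
    · simp
    · intro i h₁ h₂
      simp only [List.getElem_reverse, List.getElem_ofFn, List.length_ofFn]
      congr 1
      ext
      simp only [List.length_reverse, List.length_ofFn] at h₁
      simp only [Fin.val_rev]
      omega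
  rw [reverse_mk_polyline, hrev]

end Normed

end Polyline

end Literature.Probability.RandomPlanarGeometry
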